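import Literature.AnabelianGeometry.EtaleTheta.Discharge.Sec5TransportsSameUnitOfBiKummerData
import Literature.AnabelianGeometry.EtaleTheta.Discharge.Sec5ModelCaseBase
import Literature.AlgebraicGeometry.Frobenioids.PreFrobenioidEquivalence

/-!
# [EtTh] Thm. 4.4 (i)/(iv) inputs at the assembled §5 data: the base shadow `θ` and the Frobenius transport of `Ψ` at `A_N` from [FrdI] Thm. 3.4 (pp. 320, 334 / PDF pp. 94, 108)

Mochizuki, *The étale theta function …*, Publ. RIMS **45** (2009), Thm. 4.4 (i) p.320 (PDF p.94) ("`Ψ` induces a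
`1`-compatible self-equivalence `Ψ^bs` of the base"), proof of Thm. 5.10 (ii) p.334 (PDF p.108)
[cite: MochizukiEtTh2009, Thm 4.4 (i) p.320 (PDF p.94)]; Mochizuki, *The geometry of Frobenioids I*, Kyushu J. Math. **62** (2008),
Thm. 3.4 (iii), (v) pp.62–63 [cite: MochizukiFrdI2008, Thm. 3.4 (v) p.63].

PROOF-ONLY (no definitions, no new named facts).  abc-iut cell, layer L2, row #2-R18 / RULINGS #6 (R52) (prover abc-iut-w5-d245),
fourth file: the NAMED INPUTS `(θ, hθ)` (base shadow of `Ψ` at `A_N` through `α`) and `(Ψ^{ℕ≥1}, hdeg, hbi, hft)` (Frobenius transport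
of `Ψ` at `A_N`) of `exists_unit_strvTransport_ofBiKummerData` / `exists_unit_transports_ofBiKummerData` (p427158, p427494) are
PRODUCED for the model tempered Frobenioid:

* `PreFrobenioid.exists_baseShadow_of_compatBase` — for ANY pre-Frobenioid structure `F`, a self-equivalence `Ψ` with a
  `1`-compatible EQUIVALENCE of bases `(Ψ^bs, e_Ψ : Ψ ⋙ Base ≅ Base ⋙ Ψ^bs)` ([EtTh] Thm. 4.4 (i)) and `α : Ψ(A) ⥲ A`: the
  automorphism `θ := c⁻¹ Ψ^bs(·) c` of `Aut_D(A^bs)` (`c : Ψ^bs(A^bs) ⥲ A^bs` from `e_Ψ` and `Base(α)`) satisfies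
  `Base(α⁻¹ Ψ(f) α) = θ(Base f)`, and `Ψ` read through `α` preserves base-identity endomorphisms;
* `PreFrobenioid.degFr_conj_of_degFr_map`, `PreFrobenioid.isFrobeniusType_conj_of_map` — the Frobenius-transport clauses
  through `α` from their global forms ([FrdI] Thm. 3.4 (iii); isomorphisms are linear isometries);
* `ThetaFrobenioid.exists_psiTransportData_ofBiKummerData` — AT THE DATA: `∃ θ ΨN, hθ ∧ hdeg ∧ hbi ∧ hft` from the model
  hypotheses (`ModelFrobenioid.Hypotheses`, base of FSM-type, slim, `Φ` non-dilating, `C` not group-like), via abc-iut-L1-d4's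
  `psiBase` / `psiBase_isEquivalence` / `psiBaseSquare` ([FrdI] Thm. 3.4 (v)) and abc-iut-L1-t13's
  `FrdI.thm34iii_morphisms_of_isOfFSMType` ([FrdI] Thm. 3.4 (iii)); hence
  `ThetaFrobenioid.exists_unit_transports_ofBiKummerData_model` — `hT ∧ hT′ ∧ hu ∧ hstrv` with ONE unit `e`, whose ONLY remaining
  named inputs are the section pair of `s^trv_N` («arises from a base-Frobenius pair of `A_N`») and Prop. 5.3 (vi) at `A_N`
  (`e = 1` form).  The base shadow is PRODUCED (`∃ θ`); a consumer that also needs p421202's `hγ` for it supplies `γ` on the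
  temperoid side (anabelian input, not touched here).

Nothing asserts that the §5 data exist for an actual curve; no side is taken on [IUTchIII] Cor. 3.12.
-/

noncomputable section

open CategoryTheory

namespace Literature.AlgebraicGeometry.Frobenioids

namespace PreFrobenioid

universe w v v' u u'

variable {D : Type u} [Category.{v} D] {Φ : Dᵒᵖ ⥤ CommMonCat.{w}}
  {C : Type u'} [Category.{v'} C] (F : C ⥤ ElemFrobenioid Φ)

/-- **The base shadow of `Ψ` at `A`** ([EtTh] Thm. 4.4 (i): the `1`-compatible `Ψ^bs`; [FrdI] Thm. 3.4 (v)): for a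
self-equivalence `Ψ` with an EQUIVALENCE `Ψ^bs` of the base and `e_Ψ : Ψ ⋙ Base ≅ Base ⋙ Ψ^bs`, and `α : Ψ(A) ⥲ A`, there is a
group automorphism `θ` of `Aut_D(A^bs)` with `Base(α⁻¹ ≫ Ψ(f) ≫ α) = θ(Base f)` for every `f ∈ Aut_C(A)`; moreover `Ψ` read
through `α` carries base-identity endomorphisms of `A` to base-identity endomorphisms.  [cite: MochizukiEtTh2009, Thm 4.4 (i) p.320 (PDF p.94)] -/
theorem exists_baseShadow_of_compatBase (Ψ : C ≌ C) (Ψbs : D ⥤ D) [Ψbs.IsEquivalence]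
    (eΨ : Ψ.functor ⋙ baseFunctor F ≅ baseFunctor F ⋙ Ψbs) {A : C} (α : Ψ.functor.obj A ≅ A) :
    ∃ θ : Aut (baseObj F A) ≃* Aut (baseObj F A),
      (∀ f : Aut A, (baseFunctor F).mapIso (α.symm ≪≫ Ψ.functor.mapIso f ≪≫ α) = θ ((baseFunctor F).mapIso f)) ∧
      ∀ f : A ⟶ A, IsBaseIdentity F f → IsBaseIdentity F (α.inv ≫ Ψ.functor.map f ≫ α.hom) := by
  -- `c : Ψ^bs(A^bs) ⥲ A^bs`
  let c : Ψbs.obj (baseObj F A) ≅ baseObj F A := (eΨ.app A).symm ≪≫ (baseFunctor F).mapIso α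
  let hff : Ψbs.FullyFaithful := Functor.FullyFaithful.ofFullyFaithful Ψbs
  refine ⟨(hff.autMulEquivOfFullyFaithful (baseObj F A)).trans c.conjAut, fun f => ?_, fun f hf => ?_⟩
  · -- naturality of `e_Ψ` on `f.hom`: `Base(Ψ f) ≫ e_A = e_A ≫ Ψ^bs(Base f)` (components with plain object types)
    set eA : (baseFunctor F).obj (Ψ.functor.obj A) ⟶ Ψbs.obj ((baseFunctor F).obj A) := eΨ.hom.app A with heA
    set eA' : Ψbs.obj ((baseFunctor F).obj A) ⟶ (baseFunctor F).obj (Ψ.functor.obj A) := eΨ.inv.app A with heA'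
    have hee : eA ≫ eA' = 𝟙 _ := eΨ.hom_inv_id_app A
    have hnat : (baseFunctor F).map (Ψ.functor.map f.hom) ≫ eA = eA ≫ Ψbs.map ((baseFunctor F).map f.hom) :=
      eΨ.hom.naturality f.hom
    rw [MulEquiv.trans_apply, Iso.conjAut_apply]
    apply Iso.ext
    change (baseFunctor F).map (α.inv ≫ Ψ.functor.map f.hom ≫ α.hom) =
      ((baseFunctor F).map α.inv ≫ eA) ≫ Ψbs.map ((baseFunctor F).map f.hom) ≫ (eA' ≫ (baseFunctor F).map α.hom)
    rw [(baseFunctor F).map_comp, (baseFunctor F).map_comp]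
    simp only [Category.assoc]
    congr 1
    rw [← Category.assoc eA, ← hnat, Category.assoc, ← Category.assoc eA, hee, Category.id_comp]
  · -- `Base(α⁻¹ ≫ Ψ(f) ≫ α) = Base(α)⁻¹ ≫ e_A ≫ Ψ^bs(𝟙) ≫ e_A⁻¹ ≫ Base(α) = 𝟙`
    set eA : (baseFunctor F).obj (Ψ.functor.obj A) ⟶ Ψbs.obj ((baseFunctor F).obj A) := eΨ.hom.app A with heA
    set eA' : Ψbs.obj ((baseFunctor F).obj A) ⟶ (baseFunctor F).obj (Ψ.functor.obj A) := eΨ.inv.app A with heA'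
    have hee : eA ≫ eA' = 𝟙 _ := eΨ.hom_inv_id_app A
    have hnat : (baseFunctor F).map (Ψ.functor.map f) ≫ eA = eA ≫ Ψbs.map ((baseFunctor F).map f) :=
      eΨ.hom.naturality f
    have hf' : (baseFunctor F).map f = 𝟙 _ := hf
    rw [hf', Ψbs.map_id, Category.comp_id] at hnat
    have hΨf : (baseFunctor F).map (Ψ.functor.map f) = 𝟙 _ := by
      have h2 := congrArg (· ≫ eA') hnat
      simpa only [Category.assoc, hee, Category.comp_id] using h2
    change (baseFunctor F).map (α.inv ≫ Ψ.functor.map f ≫ α.hom) = 𝟙 _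
    rw [(baseFunctor F).map_comp, (baseFunctor F).map_comp, hΨf, Category.id_comp, ← (baseFunctor F).map_comp,
      Iso.inv_hom_id, (baseFunctor F).map_id]

/-- Frobenius degrees through `α`: if `deg_Fr(Ψ g) = Ψ^{ℕ≥1}(deg_Fr g)` for all `g` ([FrdI] Thm. 3.4 (iii)), then
`deg_Fr(α⁻¹ ≫ Ψ(f) ≫ α) = Ψ^{ℕ≥1}(deg_Fr f)` (isomorphisms are linear). [cite: MochizukiFrdI2008, Thm. 3.4 (iii) p.62] -/
theorem degFr_conj_of_degFr_map (Ψ : C ≌ C) (ΨN : ℕ+ ≃* ℕ+)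
    (hN : ∀ ⦃X Y : C⦄ (g : X ⟶ Y), degFr F (Ψ.functor.map g) = ΨN (degFr F g)) {A : C} (α : Ψ.functor.obj A ≅ A)
    (f : A ⟶ A) : degFr F (α.inv ≫ Ψ.functor.map f ≫ α.hom) = ΨN (degFr F f) := by
  rw [degFr_comp, degFr_comp, hN, show degFr F α.inv = 1 from isLinear_of_isIso F α.inv,
    show degFr F α.hom = 1 from isLinear_of_isIso F α.hom, one_mul, mul_one]

/-- Frobenius type through `α`: if `Ψ` preserves morphisms of Frobenius type ([FrdI] Thm. 3.4 (iii)), then so does `Ψ` read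
through `α` (composition with isomorphisms on either side preserves Frobenius type in a pre-Frobenioid).
[cite: MochizukiFrdI2008, Thm. 3.4 (iii) p.62] -/
theorem isFrobeniusType_conj_of_map (hP : IsPreFrobenioid Φ F) (Ψ : C ≌ C)
    (hft : ∀ ⦃X Y : C⦄ (g : X ⟶ Y), IsFrobeniusType F g → IsFrobeniusType F (Ψ.functor.map g)) {A : C}
    (α : Ψ.functor.obj A ≅ A) (f : A ⟶ A) (hf : IsFrobeniusType F f) :
    IsFrobeniusType F (α.inv ≫ Ψ.functor.map f ≫ α.hom) :=
  IsFrobeniusType.iso_comp hP α.inv ((hft f hf).comp_iso hP α.hom)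

end PreFrobenioid

end Literature.AlgebraicGeometry.Frobenioids

namespace Literature.AnabelianGeometry.EtaleTheta

open Literature.AlgebraicGeometry.Frobenioids

namespace ThetaFrobenioid

universe u₀ v₀ u v w

variable {K : Type u₀} [Field K]
  {X : SemiGraphs.TemperedArithmeticGroup.{u₀} K} {D₀ : Type u₀} [Category.{v₀} D₀]
  {V : FrdIMonoidStub.{w}} {T₀ : RealifiedDivisorMonoids (D₀ := D₀) V} {D : Type u} [Category.{v} D]
  {VD : FrdICatStub.{u, v, w} D} {S : BiKummerSetting X T₀ D VD}
  {pullFrac : ∀ {A A' : S.C} (_ : A' ⟶ A), S.biratUnits A → S.biratUnits A'}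
  {lv N : ℕ+} {T : ThetaEnvData.{max v w} N} {θr : S.biratUnits S.Aodot} {Bl : S.C}
  {Pl : S.FractionPair θr Bl} {Rl : S.NthRoot θr Pl lv pullFrac}
  (h : ModelFrobenioid.Hypotheses S.tf.divisorMonoid S.tf.ratFnFunctor)
  (toB : ∀ A : S.C, S.biratUnits A →* S.tf.biratUnitsModel A) (Q : FrobenioidTheta.ThetaSubquotientStub.{w} D)
  (odd_l : Odd (lv : ℕ)) (R : S.NthRoot Rl.root Rl.pair N pullFrac) (ιX : T.PiX ≃ₜ* X.Pi)
  (hopen : IsOpen ((S.galoisSurj R.AN.base R.αData.isGalois).ker : Set X.Pi)) (σ : Aut R.AN.base →* Aut R.AN)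
  (K' : Type w) [Field K'] (constEmb : K'ˣ →* S.tf.biratUnitsModel R.BN)
  (constEmb_injective : Function.Injective constEmb)
  (hdivc : ∀ g : Aut R.BN.base,
    ModelFrobenioid.div ((σ ((BiKummerSetting.NthRoot.baseIso S R).conjAut.symm g)).hom ≫ R.pair.num) =
      ModelFrobenioid.div R.pair.num)
  (hdivp : ∀ y : T.PiYdd,
    ModelFrobenioid.div ((σ (S.galoisSurj R.AN.base R.αData.isGalois (ιX y.1))).hom ≫ R.pair.den) =
      ModelFrobenioid.div R.pair.den)

include h in
/-- **The base shadow and the Frobenius transport of `Ψ` at `A_N`, for the model** ([EtTh] Thm. 4.4 (i) + [FrdI] Thm. 3.4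
(iii)/(v)): for a self-equivalence `Ψ` of the model tempered Frobenioid of the §4 setting over a slim base of FSM-type with `Φ`
non-dilating and `C` not of group-like type ([EtTh] Thm. 3.7 (i)(ii)), and `α : Ψ(A_N) ⥲ A_N`, the four named inputs
`θ/hθ, Ψ^{ℕ≥1}/hdeg, hbi, hft` of `exists_unit_strvTransport_ofBiKummerData` EXIST — `Ψ^bs` = abc-iut-L1-d4's `psiBase` (an
equivalence, `psiBase_isEquivalence`; square `psiBaseSquare`), the Frobenius clauses = abc-iut-L1-t13's
`FrdI.thm34iii_morphisms_of_isOfFSMType`.  [cite: MochizukiEtTh2009, Thm 4.4 (i) p.320 (PDF p.94)] -/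
theorem exists_psiTransportData_ofBiKummerData (hD : IsOfFSMType D) (hslim : IsSlim D)
    (hnd : IsNonDilatingOn S.tf.divisorMonoid)
    (hN : ∃ A : S.C, ¬ (PreFrobenioidData.ofModel S.tf.divisorMonoid S.tf.ratFnFunctor S.tf.divBNatTrans).IsGroupLikeObj A)
    (Ψ : S.C ≌ S.C) (α : Ψ.functor.obj R.AN ≅ R.AN) :
    ∃ (θ : Aut R.AN.base ≃* Aut R.AN.base) (ΨN : ℕ+ ≃* ℕ+),
      (∀ f : Aut R.AN, (PreFrobenioid.baseFunctor S.F).mapIso (α.symm ≪≫ Ψ.functor.mapIso f ≪≫ α) =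
        θ ((PreFrobenioid.baseFunctor S.F).mapIso f)) ∧
      (∀ f : R.AN ⟶ R.AN, PreFrobenioid.degFr S.F (α.inv ≫ Ψ.functor.map f ≫ α.hom) = ΨN (PreFrobenioid.degFr S.F f)) ∧
      (∀ f : R.AN ⟶ R.AN, PreFrobenioid.IsBaseIdentity S.F f →
        PreFrobenioid.IsBaseIdentity S.F (α.inv ≫ Ψ.functor.map f ≫ α.hom)) ∧
      (∀ f : R.AN ⟶ R.AN, PreFrobenioid.IsFrobeniusType S.F f →
        PreFrobenioid.IsFrobeniusType S.F (α.inv ≫ Ψ.functor.map f ≫ α.hom)) := by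
  have hF : PreFrobenioid.IsFrobenioid S.F :=
    ModelFrobenioid.isFrobenioid (DivB := S.tf.divBNatTrans) h.isMonoidOn h.isDivisorial h.isMonoidOn_rat
      h.isGroupLike_rat h.isGraphConnected h.isTotallyEpimorphic
  -- [FrdI] Thm. 3.4 (iii): the seven preservation clauses and `Ψ^{ℕ≥1}`, for `Ψ` and `Ψ⁻¹`
  have hq := ModelFrobenioid.data_isOfQuasiIsotropicType (DivB := S.tf.divBNatTrans) h
  have hnd' : (ModelFrobenioid.data S.tf.divisorMonoid S.tf.ratFnFunctor S.tf.divBNatTrans).IsNonDilatingOn :=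
    (ModelFrobenioid.data_isNonDilatingOn_iff S.tf.divisorMonoid S.tf.ratFnFunctor S.tf.divBNatTrans).mpr hnd
  obtain ⟨hlist, ΨN, hN', -⟩ := FrdI.thm34iii_morphisms_of_isOfFSMType hF hF hq hq hD hD hnd' hnd' Ψ hN hN
  obtain ⟨hlist', -⟩ := FrdI.thm34iii_morphisms_of_isOfFSMType hF hF hq hq hD hD hnd' hnd' Ψ.symm hN hN
  -- [FrdI] Thm. 3.4 (v), first sentence (slim base): `Ψ`, `Ψ⁻¹` preserve base-equivalent pairs; Thm. 3.4 (ii): pre-steps ↦ base-isos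
  have hbeF : ∀ ⦃A B : S.C⦄ (φ ψ : A ⟶ B), PreFrobenioid.BaseEquivalent S.F φ ψ →
      PreFrobenioid.BaseEquivalent S.F (Ψ.functor.map φ) (Ψ.functor.map ψ) := fun A B φ ψ hφψ =>
    PreFrobenioid.baseEquivalent_map_of_isSlim hF hF Ψ hslim (fun X Y f hf => hlist.2.2.1 f hf) hφψ
  have hbeF' : ∀ ⦃A B : S.C⦄ (φ ψ : A ⟶ B), PreFrobenioid.BaseEquivalent S.F φ ψ →
      PreFrobenioid.BaseEquivalent S.F (Ψ.inverse.map φ) (Ψ.inverse.map ψ) := fun A B φ ψ hφψ =>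
    PreFrobenioid.baseEquivalent_map_of_isSlim hF hF Ψ.symm hslim (fun X Y f hf => hlist'.2.2.1 f hf) hφψ
  have hbi := isIso_base_map_of_isPreStep_model (DivB := S.tf.divBNatTrans) Ψ h hD
  have hbi' : ∀ ⦃Y A : S.C⦄ (a : Y ⟶ A), PreFrobenioid.IsPreStep S.F a →
      IsIso (PreFrobenioid.Base S.F (Ψ.inverse.map a)) :=
    isIso_base_map_of_isPreStep_model (DivB := S.tf.divBNatTrans) Ψ.symm h hD
  haveI := PreFrobenioid.psiBase_isEquivalence hF hF Ψ hbi hbeF hbi' hbeF'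
  obtain ⟨θ, hθ, hbi0⟩ := PreFrobenioid.exists_baseShadow_of_compatBase S.F Ψ
    (PreFrobenioid.psiBase hF Ψ.functor hbi hbeF) (PreFrobenioid.psiBaseSquare hF Ψ.functor hbi hbeF) α
  -- [FrdI] Thm. 3.4 (iii): Frobenius type and degrees through `α`
  have hftF : ∀ ⦃A B : S.C⦄ (g : A ⟶ B), PreFrobenioid.IsFrobeniusType S.F g →
      PreFrobenioid.IsFrobeniusType S.F (Ψ.functor.map g) := fun A B g hg =>
    (PreFrobenioidData.ofFunctor_isFrobeniusType _ _).mp (hlist.1 g ((PreFrobenioidData.ofFunctor_isFrobeniusType _ _).mpr hg))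
  have hNF : ∀ ⦃A B : S.C⦄ (g : A ⟶ B), PreFrobenioid.degFr S.F (Ψ.functor.map g) = ΨN (PreFrobenioid.degFr S.F g) := hN'
  exact ⟨θ, ΨN, hθ, fun f => PreFrobenioid.degFr_conj_of_degFr_map S.F Ψ ΨN hNF α f, hbi0,
    fun f hf => PreFrobenioid.isFrobeniusType_conj_of_map S.F hF.isPreFrobenioid Ψ hftF α f hf⟩

/-- **`hT ∧ hT′ ∧ hu ∧ hstrv` with ONE unit `e`, for the model, base shadow PRODUCED** ([EtTh] Thm. 5.10 (ii), first sentences,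
p.334): `exists_unit_transports_ofBiKummerData` (p427494) with its inputs `(θ, hθ, Ψ^{ℕ≥1}, hdeg, hbi, hft)` and `hbe` DISCHARGED
by `exists_psiTransportData_ofBiKummerData` / `baseEquivalent_map_of_model`.  Remaining named inputs: the section pair
`(σ, φ)` of `s^trv_N` and Prop. 5.3 (vi) at `A_N` (`e = 1` form); model hypotheses: base of FSM-type, slim, `Φ` non-dilating,
`C` not group-like.  [cite: MochizukiEtTh2009, Thm 5.10 (ii) p.334 (PDF p.108)] -/
theorem exists_unit_transports_ofBiKummerData_model (hD : IsOfFSMType D) (hslim : IsSlim D)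
    (hnd : IsNonDilatingOn S.tf.divisorMonoid)
    (hN : ∃ A : S.C, ¬ (PreFrobenioidData.ofModel S.tf.divisorMonoid S.tf.ratFnFunctor S.tf.divBNatTrans).IsGroupLikeObj A)
    (hσ : ∀ g : Aut R.AN.base, ModelFrobenioid.baseMap (σ g).hom = g.hom)
    (φ : ℕ+ →* End R.AN)
    (hφ : ∀ n : ℕ+, PreFrobenioid.degFr S.F (End.asHom (φ n)) = n ∧
      PreFrobenioid.IsBaseIdentity S.F (End.asHom (φ n)) ∧ PreFrobenioid.IsFrobeniusType S.F (End.asHom (φ n)))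
    (hc : ∀ (n : ℕ+) (g : Aut R.AN.base), (σ g).hom ≫ End.asHom (φ n) = End.asHom (φ n) ≫ (σ g).hom)
    (Ψ : S.C ≌ S.C)
    (α : Ψ.functor.obj (ofBiKummerData h toB Q odd_l R ιX hopen σ K' constEmb constEmb_injective hdivc hdivp).AN ≅
      (ofBiKummerData h toB Q odd_l R ιX hopen σ K' constEmb constEmb_injective hdivc hdivp).AN)
    (β : Ψ.functor.obj (ofBiKummerData h toB Q odd_l R ιX hopen σ K' constEmb constEmb_injective hdivc hdivp).BN ≅
      (ofBiKummerData h toB Q odd_l R ιX hopen σ K' constEmb constEmb_injective hdivc hdivp).BN)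
    (hdivcap₁ : (ofBiKummerData h toB Q odd_l R ιX hopen σ K' constEmb constEmb_injective hdivc hdivp).pre.div
        (α.inv ≫ Ψ.functor.map (ofBiKummerData h toB Q odd_l R ιX hopen σ K' constEmb constEmb_injective hdivc hdivp).sCap ≫
          β.hom) =
      (ofBiKummerData h toB Q odd_l R ιX hopen σ K' constEmb constEmb_injective hdivc hdivp).pre.div
        (ofBiKummerData h toB Q odd_l R ιX hopen σ K' constEmb constEmb_injective hdivc hdivp).sCap)
    (hdivcup₁ : (ofBiKummerData h toB Q odd_l R ιX hopen σ K' constEmb constEmb_injective hdivc hdivp).pre.div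
        (α.inv ≫ Ψ.functor.map (ofBiKummerData h toB Q odd_l R ιX hopen σ K' constEmb constEmb_injective hdivc hdivp).sCup ≫
          β.hom) =
      (ofBiKummerData h toB Q odd_l R ιX hopen σ K' constEmb constEmb_injective hdivc hdivp).pre.div
        (ofBiKummerData h toB Q odd_l R ιX hopen σ K' constEmb constEmb_injective hdivc hdivp).sCup) :
    ∃ (θ : Aut R.AN.base ≃* Aut R.AN.base),
      ∃ e ∈ (ofBiKummerData h toB Q odd_l R ιX hopen σ K' constEmb constEmb_injective hdivc hdivp).units
          (ofBiKummerData h toB Q odd_l R ιX hopen σ K' constEmb constEmb_injective hdivc hdivp).AN,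
        ∃ Dc Dp : Aut (ofBiKummerData h toB Q odd_l R ιX hopen σ K' constEmb constEmb_injective hdivc hdivp).BN,
          α.inv ≫ Ψ.functor.map (ofBiKummerData h toB Q odd_l R ιX hopen σ K' constEmb constEmb_injective hdivc hdivp).sCap ≫
              (β ≪≫ Dc.symm).hom =
            e.hom ≫ (ofBiKummerData h toB Q odd_l R ιX hopen σ K' constEmb constEmb_injective hdivc hdivp).sCap ≫
              (1 : Aut (ofBiKummerData h toB Q odd_l R ιX hopen σ K' constEmb constEmb_injective hdivc hdivp).BN).hom ∧
          α.inv ≫ Ψ.functor.map (ofBiKummerData h toB Q odd_l R ιX hopen σ K' constEmb constEmb_injective hdivc hdivp).sCup ≫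
              (β ≪≫ Dc.symm).hom =
            e.hom ≫ (ofBiKummerData h toB Q odd_l R ιX hopen σ K' constEmb constEmb_injective hdivc hdivp).sCup ≫ Dp.hom ∧
          Dp ∈ (ofBiKummerData h toB Q odd_l R ιX hopen σ K' constEmb constEmb_injective hdivc hdivp).units
            (ofBiKummerData h toB Q odd_l R ιX hopen σ K' constEmb constEmb_injective hdivc hdivp).BN ∧
          (ofBiKummerData h toB Q odd_l R ιX hopen σ K' constEmb constEmb_injective hdivc hdivp).StrvTransport Ψ α e
            (((ofBiKummerData h toB Q odd_l R ιX hopen σ K' constEmb constEmb_injective hdivc hdivp).autBaseIsoAB.symm.trans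
              θ).trans (ofBiKummerData h toB Q odd_l R ιX hopen σ K' constEmb constEmb_injective hdivc hdivp).autBaseIsoAB) := by
  obtain ⟨θ, ΨN, hθ, hdeg, hbi, hft⟩ :=
    exists_psiTransportData_ofBiKummerData h R hD hslim hnd hN Ψ α
  have hbe := baseEquivalent_map_of_model
    (𝔉 := ofBiKummerData h toB Q odd_l R ιX hopen σ K' constEmb constEmb_injective hdivc hdivp)
    (ofBiKummerData_pre h toB Q odd_l R ιX hopen σ K' constEmb constEmb_injective hdivc hdivp) h hD hslim hnd hN Ψ
  obtain ⟨e, he, Dc, Dp, hT, hT', hu, hstrv⟩ :=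
    exists_unit_transports_ofBiKummerData h toB Q odd_l R ιX hopen σ K' constEmb constEmb_injective hdivc hdivp hD Ψ hbe hσ φ
      hφ hc α β θ hθ ΨN hdeg hbi hft hdivcap₁ hdivcup₁
  exact ⟨θ, e, he, Dc, Dp, hT, hT', hu, hstrv⟩

end ThetaFrobenioid

end Literature.AnabelianGeometry.EtaleTheta

end
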